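import Summits.QuantumFields.YangMills.Theorems.FemtoTransferGapSlabRayleigh
import Summits.QuantumFields.YangMills.Theorems.FemtoTransferGapRungW1upAlgebra
import HarnessLib

/-!
# Gauge and twist AVERAGING on the torus `(ℤ/L)³`: physical test functions, sub- and supersolutions from temporal-gauge constructions
# (lane B «VARIATIONAL LOWER» of S-BASE, crux `TwistedTraceScaling` stmt-QuantumFields-20203; support for both COARSE lanes)

The doors of `Theorems/LuscherReductionTwistedTraceScalingCoarseLowerDoors.lean` take a positive SUPERSOLUTION `h` (`K_β h ≤ Λ h`) and a
PHYSICAL positive `h` with physical multipliers.  Approximate ground states of the `L³` lattice (stiff Gaussian in linear link coordinates ⊗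
zero-mode factor ⊗ cut-offs) are written in temporal-gauge coordinates and are NOT gauge invariant; this module averages them (every `L`,
gauge group `SU(2)`): §1 symmetry algebra (gauge transformations compose, twists commute with them and with each other, `twist k (−1)` is an
involution); §2 `gaugeAvg φ (U) = ∫ φ(U^g) dg` (Haar probability on `SU(2)^{sites}`), `symTwist k φ = ½(φ + φ ∘ twist_k(−1))`,
`physAvg = symTwist 2 ∘ symTwist 1 ∘ symTwist 0 ∘ gaugeAvg` — measurable, bounds preserved, monotone, ★ `isPhys_physAvg`; §3 ★ `transferApply_gaugeAvg`,
`transferApply_physAvg` — the transfer operator COMMUTES with the averaging (kernel invariance, invariant a-priori measure, Fubini); §4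
★ `physAvg_supersolution` (`K_βφ ≤ Λφ` everywhere ⇒ the same for `physAvg φ`), ★ `physAvg_subsolution` (`Λ'φ ≤ K_βφ` on a gauge- and
twist-invariant set ⇒ the same for `physAvg φ` there).  HONEST FRAMING: symmetry bookkeeping and Fubini only; no kernel estimate; femto rung
R2b1 (stub of a child of a CONDITIONAL route); not a gap, not Clay.
-/

set_option autoImplicit false

noncomputable section

open MeasureTheory Filter Topology Real
open Literature.MathematicalPhysics.QuantumFieldTheory
open Literature.MathematicalPhysics.QuantumLattice

namespace Summit.QuantumFields.YangMills.Theorems.FemtoTransferGap.TwoLattice.Avg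

open Summit.QuantumFields.YangMills.Theorems.FemtoTransferGap

variable {L : ℕ} [NeZero L]

/-! ## §1 Algebra of gauge transformations and centre twists -/

omit [NeZero L] in
/-- Composition of gauge transformations is the gauge transformation by the pointwise product. [folklore] -/
theorem gaugeTransform_gaugeTransform (g g' : Site 3 L → SU2) (U : GaugeConfig 3 L SU2) :
    gaugeTransform g (gaugeTransform g' U) = gaugeTransform (g * g') U := by
  funext e
  simp only [gaugeTransform, Pi.mul_apply, mul_inv_rev]
  group

omit [NeZero L] in
/-- A centre twist commutes with every gauge transformation (the twist factor is central). [folklore] -/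
theorem twist_gaugeTransform {z : SU2} (hz : z ∈ Subgroup.center SU2) (k : Fin 3) (g : Site 3 L → SU2) (U : GaugeConfig 3 L SU2) :
    twist k z (gaugeTransform g U) = gaugeTransform g (twist k z U) := by
  funext e
  by_cases h : e.2 = k ∧ e.1 k = 0
  · simp only [twist, gaugeTransform, h, and_self, if_true]
    have hc := Subgroup.mem_center_iff.mp hz (g e.1)
    rw [show g e.1 * (z * U e) = g e.1 * z * U e from (mul_assoc _ _ _).symm, hc]
    simp only [mul_assoc]
  · simp only [twist, gaugeTransform, h, if_false]

omit [NeZero L] in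
/-- Twists by `−1` in two directions commute. [folklore] -/
theorem twist_negOne_comm (j k : Fin 3) (U : GaugeConfig 3 L SU2) :
    twist j negOne (twist k negOne U) = twist k negOne (twist j negOne U) := by
  funext e; by_cases hj : e.2 = j ∧ e.1 j = 0 <;> by_cases hk : e.2 = k ∧ e.1 k = 0 <;> simp [twist, hj, hk]

omit [NeZero L] in
/-- The twist by `−1` is an involution. [folklore] -/
theorem twist_negOne_twist_negOne (k : Fin 3) (U : GaugeConfig 3 L SU2) : twist k negOne (twist k negOne U) = U := by
  funext e
  by_cases hk : e.2 = k ∧ e.1 k = 0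
  · simp only [twist, hk, and_self, if_true, ← mul_assoc, negOne_mul_negOne, one_mul]
  · simp only [twist, hk, if_false]

/-- Twists are measurable maps of the configuration space. [folklore] -/
theorem measurable_twist (k : Fin 3) (z : SU2) : Measurable (twist k z : GaugeConfig 3 L SU2 → GaugeConfig 3 L SU2) :=
  (measurePreserving_twist (L := L) k z).measurable

omit [NeZero L] in
/-- `g ↦ U^g` is measurable for every configuration `U`. [folklore] -/
theorem measurable_gaugeTransform_left (U : GaugeConfig 3 L SU2) : Measurable fun g : Site 3 L → SU2 => gaugeTransform g U := by
  refine measurable_pi_lambda _ fun e => ?_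
  simp only [gaugeTransform]
  exact ((measurable_pi_apply e.1).mul measurable_const).mul (measurable_pi_apply (e.1.shift e.2)).inv

omit [NeZero L] in
/-- `g ↦ φ(U^g)` is measurable for measurable `φ`. [folklore] -/
theorem measurable_comp_gaugeTransform_left {φ : GaugeConfig 3 L SU2 → ℝ} (hφ : Measurable φ) (U : GaugeConfig 3 L SU2) :
    Measurable fun g : Site 3 L → SU2 => φ (gaugeTransform g U) := by
  have h := hφ.comp (measurable_gaugeTransform_left U)
  exact h

omit [NeZero L] in
/-- `(U, g) ↦ φ(U^g)` is jointly measurable for measurable `φ`. [folklore] -/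
theorem measurable_comp_gaugeAction {φ : GaugeConfig 3 L SU2 → ℝ} (hφ : Measurable φ) :
    Measurable fun p : GaugeConfig 3 L SU2 × (Site 3 L → SU2) => φ (gaugeTransform p.2 p.1) := by
  have h1 : Measurable fun p : GaugeConfig 3 L SU2 × (Site 3 L → SU2) => gaugeTransform p.2 p.1 := by
    refine measurable_pi_lambda _ fun e => ?_
    simp only [gaugeTransform]
    exact ((((measurable_pi_apply e.1).comp measurable_snd).mul ((measurable_pi_apply e).comp measurable_fst)).mul
      ((measurable_pi_apply (e.1.shift e.2)).comp measurable_snd).inv)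
  have h := hφ.comp h1
  exact h

/-! ## §2 The averaging operators -/

variable (L) in
/-- Haar probability measure on the gauge group `SU(2)^{sites}` of the torus `(ℤ/L)³` (product of normalised Haar measures; a right-invariant
probability measure). [cite: SeilerLNP1982, §2] -/
abbrev gaugeMeasure : Measure (Site 3 L → SU2) := Measure.pi fun _ => haarProbability SU2

/-- **Gauge average** `(gaugeAvg φ)(U) = ∫ φ(U^g) dg` over the Haar probability of the gauge group. [cite: SeilerLNP1982, §2] -/
def gaugeAvg (φ : GaugeConfig 3 L SU2 → ℝ) : GaugeConfig 3 L SU2 → ℝ :=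
  fun U => ∫ g, φ (gaugeTransform g U) ∂gaugeMeasure L

/-- **Twist symmetrisation** in direction `k`: `(symTwist k φ)(U) = ½(φ(U) + φ(twist_k(−1) U))`. [cite: tHooft1979] [cite: Luscher1983, §2] -/
def symTwist (k : Fin 3) (φ : GaugeConfig 3 L SU2 → ℝ) : GaugeConfig 3 L SU2 → ℝ :=
  fun U => (φ U + φ (twist k negOne U)) / 2

/-- **Physical average**: gauge average followed by the three twist symmetrisations. [cite: Luscher1983, §2] -/
def physAvg (φ : GaugeConfig 3 L SU2 → ℝ) : GaugeConfig 3 L SU2 → ℝ :=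
  symTwist 2 (symTwist 1 (symTwist 0 (gaugeAvg φ)))

/-- `gaugeAvg φ` is measurable for measurable `φ` (Fubini measurability of a jointly measurable integrand). [folklore] -/
theorem measurable_gaugeAvg {φ : GaugeConfig 3 L SU2 → ℝ} (hφ : Measurable φ) : Measurable (gaugeAvg φ) := by
  have hF : StronglyMeasurable fun p : GaugeConfig 3 L SU2 × (Site 3 L → SU2) => φ (gaugeTransform p.2 p.1) :=
    (measurable_comp_gaugeAction hφ).stronglyMeasurable
  exact (hF.integral_prod_right' (ν := gaugeMeasure L)).measurable

/-- Bounds pass through the gauge average: `c ≤ φ ≤ C` ⇒ `c ≤ gaugeAvg φ ≤ C`. [folklore] -/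
theorem gaugeAvg_mem_Icc {φ : GaugeConfig 3 L SU2 → ℝ} (hφ : Measurable φ) {c C : ℝ} (hc : ∀ U, c ≤ φ U) (hC : ∀ U, φ U ≤ C)
    (U : GaugeConfig 3 L SU2) : c ≤ gaugeAvg φ U ∧ gaugeAvg φ U ≤ C := by
  have hm : Measurable fun g : Site 3 L → SU2 => φ (gaugeTransform g U) := measurable_comp_gaugeTransform_left hφ U
  have hb : ∀ g : Site 3 L → SU2, |φ (gaugeTransform g U)| ≤ max |c| |C| := fun g =>
    abs_le_max_abs_abs (hc _) (hC _)
  have hint : Integrable (fun g : Site 3 L → SU2 => φ (gaugeTransform g U)) (gaugeMeasure L) :=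
    integrable_of_measurable_abs_le _ hm hb
  have hc' : ∫ _g : Site 3 L → SU2, c ∂gaugeMeasure L = c := by simp [integral_const]
  have hC' : ∫ _g : Site 3 L → SU2, C ∂gaugeMeasure L = C := by simp [integral_const]
  unfold gaugeAvg
  constructor
  · have h := integral_mono (integrable_const c) hint fun g => hc (gaugeTransform g U)
    rwa [hc'] at h
  · have h := integral_mono hint (integrable_const C) fun g => hC (gaugeTransform g U)
    rwa [hC'] at h

/-- `|gaugeAvg φ| ≤ C` when `|φ| ≤ C`. [folklore] -/
theorem abs_gaugeAvg_le {φ : GaugeConfig 3 L SU2 → ℝ} (hφ : Measurable φ) {C : ℝ} (hC : ∀ U, |φ U| ≤ C) (U : GaugeConfig 3 L SU2) :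
    |gaugeAvg φ U| ≤ C :=
  abs_le.mpr (gaugeAvg_mem_Icc hφ (fun U => (abs_le.mp (hC U)).1) (fun U => (abs_le.mp (hC U)).2) U)

/-- The gauge average is MONOTONE: `φ ≤ ψ` pointwise (bounded measurable) ⇒ `gaugeAvg φ ≤ gaugeAvg ψ`. [folklore] -/
theorem gaugeAvg_mono {φ ψ : GaugeConfig 3 L SU2 → ℝ} (hφ : Measurable φ) (hψ : Measurable ψ) {C D : ℝ} (hφb : ∀ U, |φ U| ≤ C)
    (hψb : ∀ U, |ψ U| ≤ D) (hle : ∀ U, φ U ≤ ψ U) (U : GaugeConfig 3 L SU2) : gaugeAvg φ U ≤ gaugeAvg ψ U := by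
  unfold gaugeAvg
  exact integral_mono (integrable_of_measurable_abs_le _ (measurable_comp_gaugeTransform_left hφ U) fun g => hφb _)
    (integrable_of_measurable_abs_le _ (measurable_comp_gaugeTransform_left hψ U) fun g => hψb _) fun g => hle _

/-- The gauge average of `Λ·φ` is `Λ·(gaugeAvg φ)`. [folklore] -/
theorem gaugeAvg_const_mul (Λ : ℝ) (φ : GaugeConfig 3 L SU2 → ℝ) (U : GaugeConfig 3 L SU2) :
    gaugeAvg (fun V => Λ * φ V) U = Λ * gaugeAvg φ U := by
  unfold gaugeAvg; exact integral_const_mul Λ _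

/-- ★ The gauge average is GAUGE INVARIANT (right invariance of Haar on the gauge group). [cite: SeilerLNP1982, §2] -/
theorem gaugeAvg_gaugeTransform (φ : GaugeConfig 3 L SU2 → ℝ) (g' : Site 3 L → SU2) (U : GaugeConfig 3 L SU2) :
    gaugeAvg φ (gaugeTransform g' U) = gaugeAvg φ U := by
  unfold gaugeAvg
  simp only [gaugeTransform_gaugeTransform]
  exact integral_mul_right_eq_self (fun g => φ (gaugeTransform g U)) g'

/-- The gauge average of a twist-invariant function is twist-invariant (twists commute with gauge transformations). [folklore] -/
theorem gaugeAvg_twist {φ : GaugeConfig 3 L SU2 → ℝ} {k : Fin 3} {z : SU2} (hz : z ∈ Subgroup.center SU2)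
    (hφ : ∀ U, φ (twist k z U) = φ U) (U : GaugeConfig 3 L SU2) : gaugeAvg φ (twist k z U) = gaugeAvg φ U := by
  unfold gaugeAvg
  simp only [← twist_gaugeTransform hz, hφ]

omit [NeZero L] in
/-- `symTwist k φ` is invariant under the twist by `−1` in direction `k`. [folklore] -/
theorem symTwist_twist_self (k : Fin 3) (φ : GaugeConfig 3 L SU2 → ℝ) (U : GaugeConfig 3 L SU2) :
    symTwist k φ (twist k negOne U) = symTwist k φ U := by
  simp only [symTwist, twist_negOne_twist_negOne]; ring

omit [NeZero L] in
/-- `symTwist k` preserves invariance under the twist by `−1` in another direction. [folklore] -/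
theorem symTwist_twist_other {j : Fin 3} (k : Fin 3) {φ : GaugeConfig 3 L SU2 → ℝ} (hφ : ∀ U, φ (twist j negOne U) = φ U)
    (U : GaugeConfig 3 L SU2) : symTwist k φ (twist j negOne U) = symTwist k φ U := by
  simp only [symTwist, twist_negOne_comm k j, hφ]

omit [NeZero L] in
/-- `symTwist k` preserves gauge invariance. [folklore] -/
theorem symTwist_gaugeTransform (k : Fin 3) {φ : GaugeConfig 3 L SU2 → ℝ} (hφ : ∀ g U, φ (gaugeTransform g U) = φ U)
    (g : Site 3 L → SU2) (U : GaugeConfig 3 L SU2) : symTwist k φ (gaugeTransform g U) = symTwist k φ U := by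
  simp only [symTwist]
  rw [twist_gaugeTransform negOne_mem_center, hφ, hφ]

/-- `symTwist k` preserves measurability. [folklore] -/
theorem measurable_symTwist (k : Fin 3) {φ : GaugeConfig 3 L SU2 → ℝ} (hφ : Measurable φ) : Measurable (symTwist k φ) :=
  (hφ.add (hφ.comp (measurable_twist k negOne))).div_const 2

omit [NeZero L] in
/-- Bounds pass through `symTwist`. [folklore] -/
theorem symTwist_mem_Icc (k : Fin 3) {φ : GaugeConfig 3 L SU2 → ℝ} {c C : ℝ} (hc : ∀ U, c ≤ φ U) (hC : ∀ U, φ U ≤ C)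
    (U : GaugeConfig 3 L SU2) : c ≤ symTwist k φ U ∧ symTwist k φ U ≤ C := by
  simp only [symTwist]
  constructor
  · have := hc U; have := hc (twist k negOne U); linarith
  · have := hC U; have := hC (twist k negOne U); linarith

omit [NeZero L] in
/-- `symTwist` is monotone. [folklore] -/
theorem symTwist_mono (k : Fin 3) {φ ψ : GaugeConfig 3 L SU2 → ℝ} (hle : ∀ U, φ U ≤ ψ U) (U : GaugeConfig 3 L SU2) :
    symTwist k φ U ≤ symTwist k ψ U := by
  simp only [symTwist]; have := hle U; have := hle (twist k negOne U); linarith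

omit [NeZero L] in
/-- `symTwist k (Λ·φ) = Λ · symTwist k φ`. [folklore] -/
theorem symTwist_const_mul (k : Fin 3) (Λ : ℝ) (φ : GaugeConfig 3 L SU2 → ℝ) (U : GaugeConfig 3 L SU2) :
    symTwist k (fun V => Λ * φ V) U = Λ * symTwist k φ U := by
  simp only [symTwist]; ring

/-- ★ **`physAvg φ` is a PHYSICAL zero-flux test function** for every bounded measurable `φ`. [cite: Luscher1983, §2] [cite: SeilerLNP1982, §2] -/
theorem isPhys_physAvg {φ : GaugeConfig 3 L SU2 → ℝ} (hφ : Measurable φ) {C : ℝ} (hC : ∀ U, |φ U| ≤ C) : IsPhys (physAvg φ) := by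
  have hm0 := measurable_gaugeAvg (L := L) hφ
  have hb0 : ∀ U, -C ≤ gaugeAvg φ U ∧ gaugeAvg φ U ≤ C := fun U =>
    gaugeAvg_mem_Icc hφ (fun U => (abs_le.mp (hC U)).1) (fun U => (abs_le.mp (hC U)).2) U
  have hg0 : ∀ g U, gaugeAvg φ (gaugeTransform g U) = gaugeAvg φ U := fun g U => gaugeAvg_gaugeTransform φ g U
  -- after symTwist 0
  have hb1 : ∀ U, -C ≤ symTwist 0 (gaugeAvg φ) U ∧ symTwist 0 (gaugeAvg φ) U ≤ C := fun U =>
    symTwist_mem_Icc 0 (fun U => (hb0 U).1) (fun U => (hb0 U).2) U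
  have hg1 : ∀ g U, symTwist 0 (gaugeAvg φ) (gaugeTransform g U) = symTwist 0 (gaugeAvg φ) U := symTwist_gaugeTransform 0 hg0
  have ht10 : ∀ U, symTwist 0 (gaugeAvg φ) (twist 0 negOne U) = symTwist 0 (gaugeAvg φ) U := symTwist_twist_self 0 _
  -- after symTwist 1
  have hb2 : ∀ U, -C ≤ symTwist 1 (symTwist 0 (gaugeAvg φ)) U ∧ symTwist 1 (symTwist 0 (gaugeAvg φ)) U ≤ C := fun U =>
    symTwist_mem_Icc 1 (fun U => (hb1 U).1) (fun U => (hb1 U).2) U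
  have hg2 : ∀ g U, symTwist 1 (symTwist 0 (gaugeAvg φ)) (gaugeTransform g U) = symTwist 1 (symTwist 0 (gaugeAvg φ)) U :=
    symTwist_gaugeTransform 1 hg1
  have ht20 : ∀ U, symTwist 1 (symTwist 0 (gaugeAvg φ)) (twist 0 negOne U) = symTwist 1 (symTwist 0 (gaugeAvg φ)) U :=
    symTwist_twist_other 1 ht10
  have ht21 : ∀ U, symTwist 1 (symTwist 0 (gaugeAvg φ)) (twist 1 negOne U) = symTwist 1 (symTwist 0 (gaugeAvg φ)) U :=
    symTwist_twist_self 1 _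
  -- after symTwist 2
  have hg3 : ∀ g U, physAvg φ (gaugeTransform g U) = physAvg φ U := symTwist_gaugeTransform 2 hg2
  have ht30 : ∀ U, physAvg φ (twist 0 negOne U) = physAvg φ U := symTwist_twist_other 2 ht20
  have ht31 : ∀ U, physAvg φ (twist 1 negOne U) = physAvg φ U := symTwist_twist_other 2 ht21
  have ht32 : ∀ U, physAvg φ (twist 2 negOne U) = physAvg φ U := symTwist_twist_self 2 _
  refine ⟨measurable_symTwist 2 (measurable_symTwist 1 (measurable_symTwist 0 hm0)), ⟨C, fun U => abs_le.mpr ?_⟩, hg3, ?_⟩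
  · exact symTwist_mem_Icc 2 (fun U => (hb2 U).1) (fun U => (hb2 U).2) U
  · intro k z hz U
    rcases eq_one_or_eq_negOne_of_mem_center hz with rfl | rfl
    · rw [twist_one]
    · fin_cases k
      · exact ht30 U
      · exact ht31 U
      · exact ht32 U

/-- Bounds pass through `physAvg`: `c ≤ φ ≤ C` (measurable) ⇒ `c ≤ physAvg φ ≤ C`. [folklore] -/
theorem physAvg_mem_Icc {φ : GaugeConfig 3 L SU2 → ℝ} (hφ : Measurable φ) {c C : ℝ} (hc : ∀ U, c ≤ φ U) (hC : ∀ U, φ U ≤ C)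
    (U : GaugeConfig 3 L SU2) : c ≤ physAvg φ U ∧ physAvg φ U ≤ C := by
  have h0 := fun U => gaugeAvg_mem_Icc hφ hc hC U
  have h1 := fun U => symTwist_mem_Icc 0 (fun U => (h0 U).1) (fun U => (h0 U).2) U
  have h2 := fun U => symTwist_mem_Icc 1 (fun U => (h1 U).1) (fun U => (h1 U).2) U
  exact symTwist_mem_Icc 2 (fun U => (h2 U).1) (fun U => (h2 U).2) U
/-! ## §3 The transfer operator commutes with the averaging -/

/-- `K_β(φ ∘ gaugeTransform g) = (K_β φ) ∘ gaugeTransform g` (kernel gauge invariance + invariance of the a-priori measure). [cite: SeilerLNP1982, §3] -/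
theorem transferApply_comp_gaugeTransform (β : ℝ) {φ : GaugeConfig 3 L SU2 → ℝ} (hφ : Measurable φ) (g : Site 3 L → SU2)
    (U : GaugeConfig 3 L SU2) : transferApply β (fun V => φ (gaugeTransform g V)) U = transferApply β φ (gaugeTransform g U) := by
  haveI : SecondCountableTopology SU2 := secondCountableTopology_su2
  rw [transferApply_apply, transferApply_apply]
  have hK : ∀ V, transferKernel su2Rep β U V = transferKernel su2Rep β (gaugeTransform g U) (gaugeTransform g V) := fun V =>
    (transferKernel_gaugeTransform su2Rep β g U V).symm
  simp_rw [hK]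
  exact integral_comp_eq_of_measurePreserving (measurePreserving_gaugeTransform_configMeasure g)
    (F := fun W => transferKernel su2Rep β (gaugeTransform g U) W * φ W) ((continuous_transferKernel_right β _).measurable.mul hφ)

/-- `K_β(φ ∘ twist k z) = (K_β φ) ∘ twist k z` for central `z`. [cite: Luscher1983, §2] -/
theorem transferApply_comp_twist (β : ℝ) {φ : GaugeConfig 3 L SU2 → ℝ} (hφ : Measurable φ) (k : Fin 3) {z : SU2}
    (hz : z ∈ Subgroup.center SU2) (U : GaugeConfig 3 L SU2) :
    transferApply β (fun V => φ (twist k z V)) U = transferApply β φ (twist k z U) := by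
  haveI : SecondCountableTopology SU2 := secondCountableTopology_su2
  rw [transferApply_apply, transferApply_apply]
  have hK : ∀ V, transferKernel su2Rep β U V = transferKernel su2Rep β (twist k z U) (twist k z V) := fun V =>
    (transferKernel_twist su2Rep β k hz U V).symm
  simp_rw [hK]
  exact integral_comp_eq_of_measurePreserving (measurePreserving_twist k z)
    (F := fun W => transferKernel su2Rep β (twist k z U) W * φ W) ((continuous_transferKernel_right β _).measurable.mul hφ)

/-- ★ **`K_β ∘ gaugeAvg = gaugeAvg ∘ K_β`** on bounded measurable functions (Fubini + `transferApply_comp_gaugeTransform`). [cite: SeilerLNP1982, §3] -/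
theorem transferApply_gaugeAvg (β : ℝ) {φ : GaugeConfig 3 L SU2 → ℝ} (hφ : Measurable φ) {C : ℝ} (hC : ∀ U, |φ U| ≤ C)
    (U : GaugeConfig 3 L SU2) : transferApply β (gaugeAvg φ) U = gaugeAvg (transferApply β φ) U := by
  haveI : SecondCountableTopology SU2 := secondCountableTopology_su2
  obtain ⟨M, hM⟩ := exists_transferKernel_le su2Rep continuous_su2Rep β (L := L)
  rw [transferApply_apply]
  unfold gaugeAvg
  -- Fubini on `configMeasure × gaugeMeasure`
  have hK1 : Measurable fun p : GaugeConfig 3 L SU2 × (Site 3 L → SU2) => transferKernel su2Rep β U p.1 := by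
    have h := (continuous_transferKernel_right β U).measurable.comp
      (measurable_fst : Measurable fun p : GaugeConfig 3 L SU2 × (Site 3 L → SU2) => p.1)
    exact h
  have hF : Measurable fun p : GaugeConfig 3 L SU2 × (Site 3 L → SU2) =>
      transferKernel su2Rep β U p.1 * φ (gaugeTransform p.2 p.1) := hK1.mul (measurable_comp_gaugeAction hφ)
  have hFb : ∀ p : GaugeConfig 3 L SU2 × (Site 3 L → SU2), |transferKernel su2Rep β U p.1 * φ (gaugeTransform p.2 p.1)| ≤ M * C := fun p => by
    rw [abs_mul, abs_of_pos (transferKernel_pos su2Rep β U p.1)]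
    exact mul_le_mul (hM U p.1) (hC _) (abs_nonneg _) ((transferKernel_pos su2Rep β U p.1).le.trans (hM U p.1))
  have hint : Integrable (fun p : GaugeConfig 3 L SU2 × (Site 3 L → SU2) =>
      transferKernel su2Rep β U p.1 * φ (gaugeTransform p.2 p.1)) ((configMeasure SU2 L).prod (gaugeMeasure L)) :=
    integrable_of_measurable_abs_le _ hF hFb
  calc ∫ V, transferKernel su2Rep β U V * ∫ g, φ (gaugeTransform g V) ∂gaugeMeasure L ∂configMeasure SU2 L
      = ∫ V, ∫ g, transferKernel su2Rep β U V * φ (gaugeTransform g V) ∂gaugeMeasure L ∂configMeasure SU2 L := by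
        refine integral_congr_ae (ae_of_all _ fun V => ?_); exact (integral_const_mul _ _).symm
    _ = ∫ g, ∫ V, transferKernel su2Rep β U V * φ (gaugeTransform g V) ∂configMeasure SU2 L ∂gaugeMeasure L :=
        integral_integral_swap hint
    _ = ∫ g, transferApply β φ (gaugeTransform g U) ∂gaugeMeasure L := by
        refine integral_congr_ae (ae_of_all _ fun g => ?_)
        dsimp only
        rw [← transferApply_comp_gaugeTransform β hφ g U, transferApply_apply]

/-- `K_β ∘ symTwist k = symTwist k ∘ K_β` on bounded measurable functions. [cite: Luscher1983, §2] -/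
theorem transferApply_symTwist (β : ℝ) (k : Fin 3) {φ : GaugeConfig 3 L SU2 → ℝ} (hφ : Measurable φ) {C : ℝ} (hC : ∀ U, |φ U| ≤ C)
    (U : GaugeConfig 3 L SU2) : transferApply β (symTwist k φ) U = symTwist k (transferApply β φ) U := by
  have h1 := integrable_transferKernel_mul β U hφ hC
  have h2 : Integrable (fun V => transferKernel su2Rep β U V * φ (twist k negOne V)) (configMeasure SU2 L) :=
    integrable_transferKernel_mul β U (hφ.comp (measurable_twist k negOne)) (C := C) fun V => hC _
  have hR : symTwist k (transferApply β φ) U = (transferApply β φ U + transferApply β (fun V => φ (twist k negOne V)) U) / 2 := by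
    simp only [symTwist]; rw [transferApply_comp_twist β hφ k negOne_mem_center U]
  rw [hR, transferApply_apply, transferApply_apply, transferApply_apply, ← integral_add h1 h2, ← integral_div]
  refine integral_congr_ae (ae_of_all _ fun V => ?_)
  simp only [symTwist]
  ring

/-- ★ **`K_β ∘ physAvg = physAvg ∘ K_β`** on bounded measurable functions. [cite: Luscher1983, §2] [cite: SeilerLNP1982, §3] -/
theorem transferApply_physAvg (β : ℝ) {φ : GaugeConfig 3 L SU2 → ℝ} (hφ : Measurable φ) {C : ℝ} (hC : ∀ U, |φ U| ≤ C)
    (U : GaugeConfig 3 L SU2) : transferApply β (physAvg φ) U = physAvg (transferApply β φ) U := by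
  have hm0 := measurable_gaugeAvg (L := L) hφ
  have hb0 : ∀ U, |gaugeAvg φ U| ≤ C := abs_gaugeAvg_le hφ hC
  have hm1 := measurable_symTwist 0 hm0
  have hb1 : ∀ U, |symTwist 0 (gaugeAvg φ) U| ≤ C := fun U =>
    abs_le.mpr (symTwist_mem_Icc 0 (fun U => (abs_le.mp (hb0 U)).1) (fun U => (abs_le.mp (hb0 U)).2) U)
  have hm2 := measurable_symTwist 1 hm1
  have hb2 : ∀ U, |symTwist 1 (symTwist 0 (gaugeAvg φ)) U| ≤ C := fun U =>
    abs_le.mpr (symTwist_mem_Icc 1 (fun U => (abs_le.mp (hb1 U)).1) (fun U => (abs_le.mp (hb1 U)).2) U)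
  unfold physAvg
  rw [transferApply_symTwist β 2 hm2 hb2]
  have e1 : transferApply β (symTwist 1 (symTwist 0 (gaugeAvg φ))) = symTwist 1 (transferApply β (symTwist 0 (gaugeAvg φ))) :=
    funext fun V => transferApply_symTwist β 1 hm1 hb1 V
  have e0 : transferApply β (symTwist 0 (gaugeAvg φ)) = symTwist 0 (transferApply β (gaugeAvg φ)) :=
    funext fun V => transferApply_symTwist β 0 hm0 hb0 V
  have eg : transferApply β (gaugeAvg φ) = gaugeAvg (transferApply β φ) := funext fun V => transferApply_gaugeAvg β hφ hC V
  rw [e1, e0, eg]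
/-! ## §4 Sub- and supersolutions survive the averaging -/

/-- ★ **SUPERSOLUTIONS AVERAGE**: `K_βφ ≤ Λφ` everywhere (bounded measurable `φ`) ⇒ `K_β(physAvg φ) ≤ Λ·physAvg φ` everywhere.
[cite: Helffer2013, Lemma 7.1] -/
theorem physAvg_supersolution (β : ℝ) {φ : GaugeConfig 3 L SU2 → ℝ} (hφ : Measurable φ) {C : ℝ} (hC : ∀ U, |φ U| ≤ C) {Λ : ℝ}
    (hsup : ∀ U, transferApply β φ U ≤ Λ * φ U) (U : GaugeConfig 3 L SU2) :
    transferApply β (physAvg φ) U ≤ Λ * physAvg φ U := by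
  haveI : SecondCountableTopology SU2 := secondCountableTopology_su2
  obtain ⟨M, hM⟩ := exists_transferKernel_le su2Rep continuous_su2Rep β (L := L)
  rw [transferApply_physAvg β hφ hC]
  have hKm : Measurable (transferApply β φ) := measurable_transferApply β hφ
  have hKb : ∀ U, |transferApply β φ U| ≤ M * C := abs_transferApply_le β hM hφ hC
  have hΛm : Measurable fun V => Λ * φ V := hφ.const_mul Λ
  have hΛb : ∀ U, |Λ * φ U| ≤ |Λ| * C := fun U => by rw [abs_mul]; exact mul_le_mul_of_nonneg_left (hC U) (abs_nonneg _)
  -- monotonicity of the gauge average, then of the three symmetrisations; linearity pulls `Λ` out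
  have h0 : ∀ V, gaugeAvg (transferApply β φ) V ≤ Λ * gaugeAvg φ V := fun V => by
    rw [← gaugeAvg_const_mul]; exact gaugeAvg_mono hKm hΛm hKb hΛb hsup V
  have h1 : ∀ V, symTwist 0 (gaugeAvg (transferApply β φ)) V ≤ Λ * symTwist 0 (gaugeAvg φ) V := fun V => by
    rw [← symTwist_const_mul]; exact symTwist_mono 0 h0 V
  have h2 : ∀ V, symTwist 1 (symTwist 0 (gaugeAvg (transferApply β φ))) V ≤ Λ * symTwist 1 (symTwist 0 (gaugeAvg φ)) V := fun V => by
    rw [← symTwist_const_mul]; exact symTwist_mono 1 h1 V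
  unfold physAvg
  rw [← symTwist_const_mul]; exact symTwist_mono 2 h2 U

/-- ★ **SUBSOLUTIONS AVERAGE ON INVARIANT SETS**: if `B` is gauge- and twist-invariant and `Λ'φ ≤ K_βφ` on `B` (bounded measurable `φ`), then
`Λ'·physAvg φ ≤ K_β(physAvg φ)` on `B`. [cite: Helffer2013, Lemma 7.1] -/
theorem physAvg_subsolution (β : ℝ) {φ : GaugeConfig 3 L SU2 → ℝ} (hφ : Measurable φ) {C : ℝ} (hC : ∀ U, |φ U| ≤ C) {Λ' : ℝ}
    {B : Set (GaugeConfig 3 L SU2)} (hBg : ∀ g U, U ∈ B → gaugeTransform g U ∈ B) (hBt : ∀ (k : Fin 3) U, U ∈ B → twist k negOne U ∈ B)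
    (hsub : ∀ U ∈ B, Λ' * φ U ≤ transferApply β φ U) (U : GaugeConfig 3 L SU2) (hU : U ∈ B) :
    Λ' * physAvg φ U ≤ transferApply β (physAvg φ) U := by
  haveI : SecondCountableTopology SU2 := secondCountableTopology_su2
  obtain ⟨M, hM⟩ := exists_transferKernel_le su2Rep continuous_su2Rep β (L := L)
  rw [transferApply_physAvg β hφ hC]
  have hKm : Measurable (transferApply β φ) := measurable_transferApply β hφ
  have hKb : ∀ U, |transferApply β φ U| ≤ M * C := abs_transferApply_le β hM hφ hC
  -- the gauge average on `B`: integrand-wise comparison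
  have h0 : ∀ V ∈ B, Λ' * gaugeAvg φ V ≤ gaugeAvg (transferApply β φ) V := fun V hV => by
    rw [← gaugeAvg_const_mul]
    have hΛb : ∀ g : Site 3 L → SU2, |(fun W => Λ' * φ W) (gaugeTransform g V)| ≤ |Λ'| * C := fun g => by
      dsimp only; rw [abs_mul]; exact mul_le_mul_of_nonneg_left (hC _) (abs_nonneg _)
    exact integral_mono (integrable_of_measurable_abs_le _ (measurable_comp_gaugeTransform_left (hφ.const_mul Λ') V) hΛb)
      (integrable_of_measurable_abs_le _ (measurable_comp_gaugeTransform_left hKm V) fun g => hKb _) fun g => hsub _ (hBg g V hV)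
  have h1 : ∀ V ∈ B, Λ' * symTwist 0 (gaugeAvg φ) V ≤ symTwist 0 (gaugeAvg (transferApply β φ)) V := fun V hV => by
    simp only [symTwist]; have := h0 V hV; have := h0 _ (hBt 0 V hV); linarith
  have h2 : ∀ V ∈ B, Λ' * symTwist 1 (symTwist 0 (gaugeAvg φ)) V ≤ symTwist 1 (symTwist 0 (gaugeAvg (transferApply β φ))) V :=
    fun V hV => by simp only [symTwist] at h1 ⊢; have := h1 V hV; have := h1 _ (hBt 1 V hV); linarith
  unfold physAvg
  simp only [symTwist] at h2 ⊢
  have := h2 U hU; have := h2 _ (hBt 2 U hU); linarith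

end Summit.QuantumFields.YangMills.Theorems.FemtoTransferGap.TwoLattice.Avg

end
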